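import Summits.BirchSwinnertonDyer.Rank1Residual.Supersingular.BlindPointFlatTwoPrelim
import Mathlib.NumberTheory.Padics.PadicIntegers
import HarnessLib

/-!
# The blind `♭`-law at `T = −2`: the two-level ELIMINATION in `ℤ₂` (cell `b2b-bsdres`, O1 sub-cell
# `p = 2`; cc-typer-4 GEN 7, typer item (27″) "9b as a theorem", elimination step)

HONEST FRAMING (run/shared/lean/b2b/bsd-rank1-residual/, verbatim in every file): the goal of the
cell is to DELETE the COMBINATION-SHAPED residual classes of the Birch–Swinnerton-Dyer formula for
ALL analytic-rank `≤ 1` elliptic curves over `ℚ` — "full BSD formula for every rank `≤ 1` curve in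
class `C`" assembled STRICTLY from published theorems — so that the rank-`≤ 1` remainder becomes
exactly the CONSTRUCTION-SHAPED classes, which are TYPED (missing-input `Prop`s), NOT attempted.
This is not "finishing BSD". THEOREMS ONLY (pure `ℤ₂`-algebra over the integer sequences of
`BlindPointFlatTwoPrelim.lean`); nothing about any curve is asserted; nothing booked; no label moves.

THE ABSTRACT LAW (`flat_law_of_levels`). Let `a ∈ 2ℤ`, `S, S′, F, c ∈ ℤ₂` and sequences
`A_n, P_n ∈ ℤ₂` satisfy, for every `n ≥ 1` (with `c_n, d_n, e_n` the blind-point sequences of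
`u_n, v_n`):

* (V)  `A_n = −c_n S`                                         (value of the Sprung congruence at `−2`),
* (D)  `P_n + d_n S + c_n S′ + e_n F ∈ 2ⁿ ℤ₂`                 (its derivative at `−2`),
* (FE) `2(2P_n − c A_n) ∈ 2ⁿ ℤ₂`                              (the differentiated functional equation).

Then **`(9 − a²)·F + a·S = 0`**. (For a Sprung pair at a good supersingular `2`: `S = L♯(−2)`,
`S′ = L♯′(−2)`, `F = L♭(−2)`, `A_n = θ_n(−2)`, `P_n = θ_n′(−2)`, `c` = the `2`-adic exponent of
`⟨N⟩`; the instantiation is `BlindPointFlatTwo.lean`.) PROOF: (D)+(FE)+(V) give at each level the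
linear relation `4c_n S′ = −(4d_n − 2c c_n)S − 4e_n F + O(2ⁿ)`; eliminating `S′` between the levels
`n, n+1` kills `c` exactly and, by the Wronskian sum `d_{n+1}c_n − d_nc_{n+1} = 2^{n−1}Σ_{k<n−1}c_{k+1}c_{k+2}`
and Cassini `e_nc_{n+1} − e_{n+1}c_n = 2^{n−1}`, leaves `2(Σ_{k≤n} c_{k−1}c_k · S − F) ∈ (c_n, c_{n+1})ℤ₂`;
the telescoping `(9 − a²)Σ = Q_n − a` turns this into `2(aS + (9−a²)F) ∈ (Q_n, c_n, c_{n+1}) ⊂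
2^{⌊(n−1)/2⌋}ℤ₂` for every `n`, whence `0`. References for the objects: [Sprung2017] Cor. 4.4;
[Pollack2003] Thm. 6.17. Folder record: `HOME/class-closure/O1/TYPING.md` §10.
-/

set_option autoImplicit false

noncomputable section

open Literature.NumberTheory.EllipticCurves Literature.NumberTheory.EllipticCurves.Sprung2017

namespace Summit.BirchSwinnertonDyer.Rank1Residual.Supersingular

namespace BlindFlat

/-- An element of `ℤ₂` divisible by every power of `2` is `0`. [folklore] -/
theorem eq_zero_of_forall_two_pow_dvd (x : ℤ_[2]) (h : ∀ k : ℕ, (2 : ℤ_[2]) ^ k ∣ x) : x = 0 := by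
  by_contra hx
  have hpos : 0 < ‖x‖ := norm_pos_iff.mpr hx
  have hp1 : ((2 : ℝ)⁻¹) < 1 := by norm_num
  obtain ⟨k, hk⟩ := exists_pow_lt_of_lt_one hpos hp1
  have hmem : x ∈ Ideal.span {((2 : ℕ) : ℤ_[2]) ^ k} := by
    rw [Ideal.mem_span_singleton, Nat.cast_ofNat]
    exact h k
  have hle : ‖x‖ ≤ ((2 : ℕ) : ℝ) ^ (-(k : ℤ)) := (PadicInt.norm_le_pow_iff_mem_span_pow x k).mpr hmem
  rw [Nat.cast_ofNat, zpow_neg, zpow_natCast, ← inv_pow] at hle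
  exact absurd (hle.trans_lt hk) (lt_irrefl _)

/-- Casting the Wronskian sum to `ℤ₂`. [folklore] -/
theorem dSeq_wronskian_cast (a : ℤ) (n : ℕ) :
    ((dSeq a (n + 2) : ℤ) : ℤ_[2]) * (cSeq a (n + 1) : ℤ) -
        ((dSeq a (n + 1) : ℤ) : ℤ_[2]) * (cSeq a (n + 2) : ℤ) = 2 ^ n * ((pSum a n : ℤ) : ℤ_[2]) := by
  have h := dSeq_wronskian a n
  exact_mod_cast h

/-- Casting the `e`–Cassini identity to `ℤ₂`. [folklore] -/
theorem eSeq_mul_cSeq_sub_cast (a : ℤ) (n : ℕ) :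
    ((eSeq a (n + 1) : ℤ) : ℤ_[2]) * (cSeq a (n + 2) : ℤ) -
        ((eSeq a (n + 2) : ℤ) : ℤ_[2]) * (cSeq a (n + 1) : ℤ) = 2 ^ n := by
  have h := eSeq_mul_cSeq_sub a n
  exact_mod_cast h

/-- Casting the telescoping identity to `ℤ₂`. [folklore] -/
theorem sub_sq_mul_pSum_cast (a : ℤ) (n : ℕ) :
    (9 - ((a : ℤ) : ℤ_[2]) ^ 2) * ((pSum a n : ℤ) : ℤ_[2]) = ((qSeq a (n + 1) : ℤ) : ℤ_[2]) - (a : ℤ) := by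
  have h := sub_sq_mul_pSum a n
  exact_mod_cast h

/-- Casting an integer divisibility by `2^k` to `ℤ₂`. [folklore] -/
theorem two_pow_dvd_cast {k : ℕ} {z : ℤ} (h : (2 : ℤ) ^ k ∣ z) : (2 : ℤ_[2]) ^ k ∣ ((z : ℤ) : ℤ_[2]) := by
  have h' := map_dvd (Int.castRingHom ℤ_[2]) h
  simpa using h'

/-- **THE ABSTRACT BLIND `♭`-LAW.** See the module docstring: (V), (D), (FE) at every level
`n = m + 1 ≥ 1` imply `(9 − a²)·F + a·S = 0` in `ℤ₂` (`2 ∣ a`). [folklore] -/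
theorem flat_law_of_levels {a : ℤ} (ha : (2 : ℤ) ∣ a) {S S' F c : ℤ_[2]} {A P : ℕ → ℤ_[2]}
    (hV : ∀ m : ℕ, A (m + 1) = -((cSeq a (m + 1) : ℤ) : ℤ_[2]) * S)
    (hD : ∀ m : ℕ, ∃ ρ : ℤ_[2], P (m + 1) + ((dSeq a (m + 1) : ℤ) : ℤ_[2]) * S +
      ((cSeq a (m + 1) : ℤ) : ℤ_[2]) * S' + ((eSeq a (m + 1) : ℤ) : ℤ_[2]) * F = 2 ^ (m + 1) * ρ)
    (hFE : ∀ m : ℕ, ∃ g : ℤ_[2], 2 * (2 * P (m + 1) - c * A (m + 1)) = 2 ^ (m + 1) * g) :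
    (9 - ((a : ℤ) : ℤ_[2]) ^ 2) * F + ((a : ℤ) : ℤ_[2]) * S = 0 := by
  -- Step 1: the linear relation at each level (`c` enters only through `−2c·c_n·S`)
  have hL : ∀ m : ℕ, ∃ h : ℤ_[2], 4 * ((cSeq a (m + 1) : ℤ) : ℤ_[2]) * S' =
      -(4 * ((dSeq a (m + 1) : ℤ) : ℤ_[2]) - 2 * c * ((cSeq a (m + 1) : ℤ) : ℤ_[2])) * S -
        4 * ((eSeq a (m + 1) : ℤ) : ℤ_[2]) * F + 2 ^ (m + 1) * h := by
    intro m
    obtain ⟨ρ, hρ⟩ := hD m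
    obtain ⟨g, hg⟩ := hFE m
    have hA := hV m
    exact ⟨4 * ρ - g, by linear_combination 4 * hρ - hg - 2 * c * hA⟩
  -- Step 2: eliminate `S'` between the levels `m + 1` and `m + 2`; `c` cancels
  have hM : ∀ m : ℕ, ∃ h₀ h₁ : ℤ_[2], 2 * (((pSum a m : ℤ) : ℤ_[2]) * S - F) =
      -(((cSeq a (m + 2) : ℤ) : ℤ_[2]) * h₀ - 2 * ((cSeq a (m + 1) : ℤ) : ℤ_[2]) * h₁) := by
    intro m
    obtain ⟨h₀, e₀⟩ := hL m
    obtain ⟨h₁, e₁⟩ := hL (m + 1)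
    refine ⟨h₀, h₁, ?_⟩
    have hW := dSeq_wronskian_cast a m
    have hE := eSeq_mul_cSeq_sub_cast a m
    rw [show m + 1 + 1 = m + 2 by ring] at e₁
    have key : (2 : ℤ_[2]) ^ (m + 1) * (2 * (((pSum a m : ℤ) : ℤ_[2]) * S - F) +
        (((cSeq a (m + 2) : ℤ) : ℤ_[2]) * h₀ - 2 * ((cSeq a (m + 1) : ℤ) : ℤ_[2]) * h₁)) = 0 := by
      rw [pow_succ]
      linear_combination (-((cSeq a (m + 2) : ℤ) : ℤ_[2])) * e₀ + ((cSeq a (m + 1) : ℤ) : ℤ_[2]) * e₁ -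
        4 * S * hW + 4 * F * hE
    have h2 : (2 : ℤ_[2]) ^ (m + 1) ≠ 0 := pow_ne_zero _ two_ne_zero
    have h3 := (mul_eq_zero.mp key).resolve_left h2
    linear_combination h3
  -- Step 3: multiply by `9 − a²`, telescope, and read off the `2`-adic divisibility
  have hdiv : ∀ k : ℕ, (2 : ℤ_[2]) ^ k ∣
      2 * (((a : ℤ) : ℤ_[2]) * S + (9 - ((a : ℤ) : ℤ_[2]) ^ 2) * F) := by
    intro k
    obtain ⟨h₀, h₁, e⟩ := hM (2 * k)
    have hT := sub_sq_mul_pSum_cast a (2 * k)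
    have hq : (2 : ℤ_[2]) ^ k ∣ ((qSeq a (2 * k + 1) : ℤ) : ℤ_[2]) := by
      have h4 : (2 : ℤ_[2]) ^ (2 * k) ∣ ((qSeq a (2 * k + 1) : ℤ) : ℤ_[2]) :=
        two_pow_dvd_cast (pow_dvd_qSeq a ha (by omega))
      exact (pow_dvd_pow _ (by omega)).trans h4
    have hc1 : (2 : ℤ_[2]) ^ k ∣ ((cSeq a (2 * k + 1) : ℤ) : ℤ_[2]) :=
      two_pow_dvd_cast (pow_dvd_cSeq a ha _ _ (by omega))
    have hc2 : (2 : ℤ_[2]) ^ k ∣ ((cSeq a (2 * k + 2) : ℤ) : ℤ_[2]) :=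
      two_pow_dvd_cast (pow_dvd_cSeq a ha _ _ (by omega))
    have hsum : 2 * (((a : ℤ) : ℤ_[2]) * S + (9 - ((a : ℤ) : ℤ_[2]) ^ 2) * F) =
        2 * ((qSeq a (2 * k + 1) : ℤ) : ℤ_[2]) * S + (9 - ((a : ℤ) : ℤ_[2]) ^ 2) *
          (((cSeq a (2 * k + 2) : ℤ) : ℤ_[2]) * h₀ - 2 * ((cSeq a (2 * k + 1) : ℤ) : ℤ_[2]) * h₁) := by
      linear_combination -(9 - ((a : ℤ) : ℤ_[2]) ^ 2) * e + 2 * S * hT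
    rw [hsum]
    refine dvd_add ((hq.mul_left 2).mul_right S) (Dvd.dvd.mul_left (dvd_sub (hc2.mul_right h₀)
      ((hc1.mul_left 2).mul_right h₁)) _)
  have h0 := eq_zero_of_forall_two_pow_dvd _ hdiv
  have h2 : (2 : ℤ_[2]) ≠ 0 := two_ne_zero
  have h3 := (mul_eq_zero.mp h0).resolve_left h2
  linear_combination h3

end BlindFlat

end Summit.BirchSwinnertonDyer.Rank1Residual.Supersingular

end
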